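import Summits.Ventures.PercRepro0.Independence
import Summits.Ventures.PercRepro0.ContinuityCoupling
import Summits.Ventures.PercRepro0.LowerBound
import Summits.Ventures.PercRepro0.LocalLaw

/-!
# Connections inside a vertex set and the cluster of `0` in `S` (seat p4, block P5 in Lean: S1, part 1)

Objects of SHARP-p4-v2 §2–§3 on `Defs`:

* `bondsIn S` = `E(S)`, the bonds with both endpoints in `S`; `inGraph S ω` its open subgraph; `ConnIn S ω x y` = `x ↔_S y`
  («some open path from `x` to `y` lies in `S`»); its basic properties (monotonicity, endpoints in `S`, determination by
  `E(S)`, measurability for finite `S`, a walk of the lattice inside `S` witnesses it);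
* `nbrs x`, the `2d` lattice neighbours of `x` as a finset (`L2.step`), and `outNbrs S x` = `{y ∉ S : y ∼ x}`;
* `CEq S A` = `{C = A}` where `C = {x ∈ S : 0 ↔_S x}` is the `S`-cluster of `0`; the events `{C = A}`, `0 ∈ A ⊆ S`,
  partition the configurations (`exists_cEq`, `cEq_disjoint`) and `{x ∈ C} = {0 ↔_S x}` (`mem_cEq_iff_connIn`);
* `cutBonds S A` = the bonds of `E(S)` from `A` to `S ∖ A`, `touchBonds S A` = `E_A`, the bonds of `E(S)` meeting `A`;
  Claim 1 (`cEq_iff`): `C = A ⟺` every bond of `E(S)` from `A` to `S ∖ A` is closed and `0 ↔_A x` for every `x ∈ A`;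
  hence `{C = A}` is determined by `E_A` (`determinedBy_cEq`);
* the last-exit lemma (`exists_exit`): an open walk from `u` to `z ∉ A` either avoids `A` or has a last bond `{x, y}`
  with `x ∈ A`, `y ∉ A` after which it avoids `A` (SHARP Claim 2's path step).
-/

namespace Summit.Ventures.PercRepro0.Sharp

open MeasureTheory ProbabilityTheory unitInterval Set
open Summit.Ventures.PercRepro0.Defs
open scoped ENNReal Classical

variable {d : ℕ}

/-! ### Bonds and connections inside a vertex set -/

/-- `E(S)`: the bonds with both endpoints in `S`. -/
def bondsIn (S : Set (Vertex d)) : Set (Sym2 (Vertex d)) := {e | e ∈ bonds d ∧ ∀ v ∈ e, v ∈ S}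

/-- `E(S)` is monotone in `S`. -/
theorem bondsIn_mono {S T : Set (Vertex d)} (h : S ⊆ T) : bondsIn S ⊆ bondsIn T :=
  fun _ he => ⟨he.1, fun v hv => h (he.2 v hv)⟩

/-- `E(S)` consists of bonds. -/
theorem bondsIn_subset_bonds (S : Set (Vertex d)) : bondsIn S ⊆ bonds d := fun _ he => he.1

/-- `E(S)` is finite for finite `S`. -/
theorem bondsIn_finite {S : Set (Vertex d)} (hS : S.Finite) : (bondsIn S).Finite := by
  refine ((hS.prod hS).image fun ab : Vertex d × Vertex d => s(ab.1, ab.2)).subset ?_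
  intro e he
  induction e using Sym2.ind with
  | h a b => exact ⟨(a, b), ⟨he.2 a (Sym2.mem_mk_left a b), he.2 b (Sym2.mem_mk_right a b)⟩, rfl⟩

/-- The open subgraph inside `S`. -/
def inGraph (S : Set (Vertex d)) (ω : Config d) : SimpleGraph (Vertex d) :=
  SimpleGraph.fromEdgeSet (ω ∩ bondsIn S)

/-- Adjacency in the open subgraph inside `S`. -/
theorem inGraph_adj {S : Set (Vertex d)} {ω : Config d} {x y : Vertex d} :
    (inGraph S ω).Adj x y ↔ (s(x, y) ∈ ω ∧ s(x, y) ∈ bonds d ∧ x ∈ S ∧ y ∈ S) ∧ x ≠ y := by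
  rw [inGraph, SimpleGraph.fromEdgeSet_adj, Set.mem_inter_iff]
  constructor
  · rintro ⟨⟨h1, h2, h3⟩, h4⟩
    exact ⟨⟨h1, h2, h3 x (Sym2.mem_mk_left x y), h3 y (Sym2.mem_mk_right x y)⟩, h4⟩
  · rintro ⟨⟨h1, h2, h3, h4⟩, h5⟩
    refine ⟨⟨h1, h2, fun v hv => ?_⟩, h5⟩
    rcases Sym2.mem_iff.1 hv with rfl | rfl
    · exact h3
    · exact h4

/-- `x ↔_S y`: some open path from `x` to `y` lies in `S`. -/
def ConnIn (S : Set (Vertex d)) (ω : Config d) (x y : Vertex d) : Prop := (inGraph S ω).Reachable x y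

/-- The open subgraph inside `S` is a subgraph of the open graph. -/
theorem inGraph_le_openGraph (S : Set (Vertex d)) (ω : Config d) : inGraph S ω ≤ openGraph d ω :=
  SimpleGraph.fromEdgeSet_mono (Set.inter_subset_inter_right _ (bondsIn_subset_bonds S))

/-- `x ↔_S y` implies `x ↔ y`. -/
theorem conn_of_connIn {S : Set (Vertex d)} {ω : Config d} {x y : Vertex d} (h : ConnIn S ω x y) :
    Conn d ω x y :=
  h.mono (inGraph_le_openGraph S ω)

/-- The open subgraph inside `S` is monotone in `S`. -/
theorem inGraph_mono_set {S T : Set (Vertex d)} (h : S ⊆ T) (ω : Config d) : inGraph S ω ≤ inGraph T ω :=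
  SimpleGraph.fromEdgeSet_mono (Set.inter_subset_inter_right _ (bondsIn_mono h))

/-- `x ↔_S y` implies `x ↔_T y` for `S ⊆ T`. -/
theorem connIn_mono_set {S T : Set (Vertex d)} (h : S ⊆ T) {ω : Config d} {x y : Vertex d}
    (hc : ConnIn S ω x y) : ConnIn T ω x y :=
  hc.mono (inGraph_mono_set h ω)

/-- `x ↔_S x`. -/
theorem connIn_refl (S : Set (Vertex d)) (ω : Config d) (x : Vertex d) : ConnIn S ω x x :=
  SimpleGraph.Reachable.refl x

/-- `x ↔_S y` and `y ↔_S z` give `x ↔_S z`. -/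
theorem connIn_trans {S : Set (Vertex d)} {ω : Config d} {x y z : Vertex d} (h1 : ConnIn S ω x y)
    (h2 : ConnIn S ω y z) : ConnIn S ω x z :=
  h1.trans h2

/-- `x ↔_S y` is symmetric. -/
theorem connIn_symm {S : Set (Vertex d)} {ω : Config d} {x y : Vertex d} (h : ConnIn S ω x y) :
    ConnIn S ω y x :=
  h.symm

/-- A connection inside `S` from a vertex of `S` ends in `S`. -/
theorem mem_of_connIn {S : Set (Vertex d)} {ω : Config d} {x y : Vertex d} (hx : x ∈ S)
    (h : ConnIn S ω x y) : y ∈ S := by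
  obtain ⟨w⟩ := h
  induction w with
  | nil => exact hx
  | cons h _ ih => exact ih (inGraph_adj.1 h).1.2.2.2

/-- An open bond inside `S` joins its endpoints inside `S`. -/
theorem connIn_of_adj {S : Set (Vertex d)} {ω : Config d} {x y : Vertex d} (hω : s(x, y) ∈ ω)
    (hb : s(x, y) ∈ bonds d) (hx : x ∈ S) (hy : y ∈ S) : ConnIn S ω x y := by
  by_cases hxy : x = y
  · subst hxy; exact connIn_refl S ω x
  · exact (inGraph_adj.2 ⟨⟨hω, hb, hx, hy⟩, hxy⟩).reachable

/-- `x ↔_S y` iff some walk of the lattice from `x` to `y` uses only open bonds of `E(S)`. -/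
theorem connIn_iff_exists_walk (S : Set (Vertex d)) (ω : Config d) (x y : Vertex d) :
    ConnIn S ω x y ↔ ∃ w : (lattice d).Walk x y, ∀ e ∈ w.edges, e ∈ ω ∧ e ∈ bondsIn S := by
  constructor
  · rintro ⟨w⟩
    refine ⟨w.mapLe ((inGraph_le_openGraph S ω).trans (openGraph_le ω)), fun e he => ?_⟩
    rw [SimpleGraph.Walk.edges_mapLe_eq_edges] at he
    have h := w.edges_subset_edgeSet he
    rw [inGraph, SimpleGraph.edgeSet_fromEdgeSet] at h
    exact h.1
  · rintro ⟨w, hw⟩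
    refine ⟨w.transfer (inGraph S ω) fun e he => ?_⟩
    rw [inGraph, SimpleGraph.edgeSet_fromEdgeSet]
    exact ⟨hw e he, SimpleGraph.not_isDiag_of_mem_edgeSet _ (w.edges_subset_edgeSet he)⟩

/-- `{x ↔_S y}` is determined by the bonds of `E(S)`. -/
theorem determinedBy_connIn (S : Set (Vertex d)) (x y : Vertex d) :
    DeterminedBy (bondsIn S) {ω : Config d | ConnIn S ω x y} := by
  intro ω ω' h
  have hinter : ω ∩ bondsIn S = ω' ∩ bondsIn S := by
    ext e
    exact ⟨fun ⟨h1, h2⟩ => ⟨(h e h2).1 h1, h2⟩, fun ⟨h1, h2⟩ => ⟨(h e h2).2 h1, h2⟩⟩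
  show ConnIn S ω x y ↔ ConnIn S ω' x y
  unfold ConnIn inGraph
  rw [hinter]

/-- `{x ↔_S y}` is measurable for finite `S`. -/
theorem measurableSet_connIn {S : Set (Vertex d)} (hS : S.Finite) (x y : Vertex d) :
    MeasurableSet {ω : Config d | ConnIn S ω x y} :=
  Russo.measurableSet_of_determinedBy (bondsIn_finite hS) (determinedBy_connIn S x y)

/-- Opening more bonds only creates connections inside `S`. -/
theorem connIn_mono_config {S : Set (Vertex d)} {ω ω' : Config d} (h : ω ⊆ ω') {x y : Vertex d}
    (hc : ConnIn S ω x y) : ConnIn S ω' x y :=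
  hc.mono (SimpleGraph.fromEdgeSet_mono (Set.inter_subset_inter_left _ h))

/-! ### Lattice neighbours -/

/-- The `2d` lattice neighbours of `x`, as a finset. -/
noncomputable def nbrs (x : Vertex d) : Finset (Vertex d) :=
  (Finset.univ : Finset (Fin d × Bool)).image fun ib => L2.step x ib.1 ib.2

/-- `y ∈ nbrs x` iff `y` is a lattice neighbour of `x`. -/
theorem mem_nbrs {x y : Vertex d} : y ∈ nbrs x ↔ (lattice d).Adj x y := by
  constructor
  · intro h
    obtain ⟨⟨i, b⟩, -, rfl⟩ := Finset.mem_image.1 h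
    exact L2.lattice_adj_step x i b
  · intro h
    obtain ⟨i, b, hib⟩ := L2.exists_step_of_adj h
    exact Finset.mem_image.2 ⟨(i, b), Finset.mem_univ _, hib⟩

/-- The neighbours of `x` outside `S`. -/
noncomputable def outNbrs (S : Set (Vertex d)) (x : Vertex d) : Finset (Vertex d) :=
  (nbrs x).filter fun y => y ∉ S

/-- `y ∈ outNbrs S x` iff `y ∼ x` and `y ∉ S`. -/
theorem mem_outNbrs {S : Set (Vertex d)} {x y : Vertex d} :
    y ∈ outNbrs S x ↔ (lattice d).Adj x y ∧ y ∉ S := by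
  rw [outNbrs, Finset.mem_filter, mem_nbrs]

/-! ### The `S`-cluster of `0` -/

/-- `{C = A}`: the `S`-cluster of `0` is exactly `A`. -/
def CEq (S : Finset (Vertex d)) (A : Finset (Vertex d)) : Set (Config d) :=
  {ω | ∀ x ∈ S, (ConnIn (↑S) ω 0 x ↔ x ∈ A)}

/-- The candidate values of the cluster: `0 ∈ A ⊆ S`. -/
noncomputable def clusters (S : Finset (Vertex d)) : Finset (Finset (Vertex d)) :=
  S.powerset.filter fun A => (0 : Vertex d) ∈ A

/-- `A ∈ clusters S` iff `0 ∈ A ⊆ S`. -/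
theorem mem_clusters {S A : Finset (Vertex d)} : A ∈ clusters S ↔ A ⊆ S ∧ (0 : Vertex d) ∈ A := by
  rw [clusters, Finset.mem_filter, Finset.mem_powerset]

/-- Every configuration has an `S`-cluster of `0` among the candidates (`0 ∈ S`). -/
theorem exists_cEq {S : Finset (Vertex d)} (hS : (0 : Vertex d) ∈ S) (ω : Config d) :
    ∃ A ∈ clusters S, ω ∈ CEq S A := by
  refine ⟨S.filter fun x => ConnIn (↑S) ω 0 x, mem_clusters.2 ⟨Finset.filter_subset _ _,
    Finset.mem_filter.2 ⟨hS, connIn_refl _ _ _⟩⟩, fun x hx => ?_⟩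
  rw [Finset.mem_filter]
  exact ⟨fun h => ⟨hx, h⟩, fun h => h.2⟩

/-- The cluster value is unique. -/
theorem cEq_eq {S A A' : Finset (Vertex d)} (hA : A ⊆ S) (hA' : A' ⊆ S) {ω : Config d} (h : ω ∈ CEq S A)
    (h' : ω ∈ CEq S A') : A = A' := by
  ext x
  by_cases hx : x ∈ S
  · rw [← h x hx, ← h' x hx]
  · exact ⟨fun hxA => absurd (hA hxA) hx, fun hxA => absurd (hA' hxA) hx⟩

/-- `x ∈ C ⟺ 0 ↔_S x`, for `x ∈ S`. -/
theorem mem_cEq_iff_connIn {S A : Finset (Vertex d)} {ω : Config d} (h : ω ∈ CEq S A) {x : Vertex d}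
    (hx : x ∈ S) : x ∈ A ↔ ConnIn (↑S) ω 0 x :=
  (h x hx).symm

/-- `{C = A}` is determined by `E(S)`, hence measurable. -/
theorem determinedBy_cEq_bondsIn (S A : Finset (Vertex d)) : DeterminedBy (bondsIn (↑S)) (CEq S A) := by
  intro ω ω' h
  show (∀ x ∈ S, (ConnIn (↑S) ω 0 x ↔ x ∈ A)) ↔ ∀ x ∈ S, (ConnIn (↑S) ω' 0 x ↔ x ∈ A)
  have : ∀ x, ConnIn (↑S) ω 0 x ↔ ConnIn (↑S) ω' 0 x := fun x =>
    determinedBy_connIn ((S : Set (Vertex d))) 0 x ω ω' h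
  simp only [this]

/-- `{C = A}` is measurable. -/
theorem measurableSet_cEq (S A : Finset (Vertex d)) : MeasurableSet (CEq S A) :=
  Russo.measurableSet_of_determinedBy (bondsIn_finite S.finite_toSet) (determinedBy_cEq_bondsIn S A)

/-! ### The last-exit lemma (SHARP Claim 2, path step) -/

/-- A connection inside `T ∖ A` ending in `T ∖ A` starts in `T ∖ A`. -/
theorem mem_diff_of_connIn_diff {T A : Set (Vertex d)} {ω : Config d} {v z : Vertex d} (hz : z ∈ T \ A)
    (h : ConnIn (T \ A) ω v z) : v ∈ T \ A :=
  mem_of_connIn hz h.symm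

/-- **Last exit.** A walk of the open graph inside `T` from `u` to `z ∈ T ∖ A` either stays outside `A` (it is a
connection inside `T ∖ A`), or contains a bond `{x, y}` with `x ∈ A`, `y ∉ A` such that the walk after it stays
outside `A` (`y ↔_{T ∖ A} z`). -/
theorem exists_exit {T A : Set (Vertex d)} {ω : Config d} {z : Vertex d} (hz : z ∈ T \ A) :
    ∀ {u : Vertex d} (w : (inGraph T ω).Walk u z), ConnIn (T \ A) ω u z ∨
      ∃ x y : Vertex d, x ∈ A ∧ y ∉ A ∧ (inGraph T ω).Adj x y ∧ s(x, y) ∈ w.edges ∧ ConnIn (T \ A) ω y z := by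
  intro u w
  induction w with
  | nil => exact Or.inl (connIn_refl _ _ _)
  | @cons u v _ h w' ih =>
    rcases ih hz with hv | ⟨x, y, hx, hy, hadj, hmem, hc⟩
    · have hvA : v ∉ A := (mem_diff_of_connIn_diff hz hv).2
      by_cases hu : u ∈ A
      · exact Or.inr ⟨u, v, hu, hvA, h, by rw [SimpleGraph.Walk.edges_cons]; exact List.mem_cons_self, hv⟩
      · left
        refine (SimpleGraph.Adj.reachable ?_).trans hv
        obtain ⟨⟨h1, h2, h3, h4⟩, h5⟩ := inGraph_adj.1 h
        exact inGraph_adj.2 ⟨⟨h1, h2, ⟨h3, hu⟩, ⟨h4, hvA⟩⟩, h5⟩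
    · exact Or.inr ⟨x, y, hx, hy, hadj, by rw [SimpleGraph.Walk.edges_cons]; exact List.mem_cons_of_mem _ hmem, hc⟩

/-! ### Claim 1: `{C = A}` is determined by the bonds meeting `A` -/

/-- The bonds of `E(S)` from `A` to `S ∖ A`. -/
def cutBonds (S A : Set (Vertex d)) : Set (Sym2 (Vertex d)) :=
  {e | e ∈ bondsIn S ∧ (∃ v ∈ e, v ∈ A) ∧ ∃ v ∈ e, v ∉ A}

/-- `E_A`: the bonds of `E(S)` meeting `A`. -/
def touchBonds (S A : Set (Vertex d)) : Set (Sym2 (Vertex d)) := {e | e ∈ bondsIn S ∧ ∃ v ∈ e, v ∈ A}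

/-- Bonds from `A` to `S ∖ A` meet `A`. -/
theorem cutBonds_subset_touchBonds (S A : Set (Vertex d)) : cutBonds S A ⊆ touchBonds S A :=
  fun _ he => ⟨he.1, he.2.1⟩

/-- `E_A ⊆ E(S)`. -/
theorem touchBonds_subset_bondsIn (S A : Set (Vertex d)) : touchBonds S A ⊆ bondsIn S := fun _ he => he.1

/-- `E(A) ⊆ E_A` for `A ⊆ S`. -/
theorem bondsIn_subset_touchBonds {S A : Set (Vertex d)} (hA : A ⊆ S) : bondsIn A ⊆ touchBonds S A := by
  intro e he
  refine ⟨bondsIn_mono hA he, ?_⟩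
  induction e using Sym2.ind with
  | h a b => exact ⟨a, Sym2.mem_mk_left a b, he.2 a (Sym2.mem_mk_left a b)⟩

/-- **Claim 1.** `C = A` iff every bond of `E(S)` from `A` to `S ∖ A` is closed and `0 ↔_A x` for every `x ∈ A`
(`0 ∈ A ⊆ S`). -/
theorem cEq_iff {S A : Finset (Vertex d)} (hA : A ⊆ S) (h0 : (0 : Vertex d) ∈ A) {ω : Config d} :
    ω ∈ CEq S A ↔ (∀ e ∈ cutBonds (↑S) (↑A), e ∉ ω) ∧ ∀ x ∈ A, ConnIn (↑A) ω 0 x := by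
  constructor
  · intro hC
    refine ⟨fun e he hω => ?_, fun x hx => ?_⟩
    · obtain ⟨heS, ⟨u, hue, huA⟩, ⟨v, hve, hvA⟩⟩ := he
      have hne : u ≠ v := fun h => hvA (h ▸ huA)
      have hsuv : e = s(u, v) := (Sym2.mem_and_mem_iff hne).1 ⟨hue, hve⟩
      have hu0 : ConnIn (↑S) ω 0 u := (mem_cEq_iff_connIn hC (hA huA)).1 huA
      have hv0 : ConnIn (↑S) ω 0 v :=
        hu0.trans (connIn_of_adj (hsuv ▸ hω) (hsuv ▸ heS.1) (heS.2 u hue) (heS.2 v hve))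
      exact hvA ((mem_cEq_iff_connIn hC (heS.2 v hve)).2 hv0)
    · have hx0 : ConnIn (↑S) ω 0 x := (mem_cEq_iff_connIn hC (hA hx)).1 hx
      obtain ⟨w⟩ := hx0
      have hsupp : ∀ v ∈ w.support, v ∈ (↑A : Set (Vertex d)) := fun v hv => by
        have hc : ConnIn (↑S) ω 0 v := ⟨w.takeUntil v hv⟩
        exact (mem_cEq_iff_connIn hC (mem_of_connIn (hA h0) hc)).2 hc
      refine ⟨w.transfer (inGraph (↑A) ω) fun e he => ?_⟩
      have h1 := w.edges_subset_edgeSet he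
      rw [inGraph, SimpleGraph.edgeSet_fromEdgeSet] at h1 ⊢
      refine ⟨⟨h1.1.1, h1.1.2.1, fun v hv => ?_⟩, h1.2⟩
      induction e using Sym2.ind with
      | h a b =>
        rcases Sym2.mem_iff.1 hv with rfl | rfl
        · exact hsupp _ (w.fst_mem_support_of_mem_edges he)
        · exact hsupp _ (w.snd_mem_support_of_mem_edges he)
  · rintro ⟨hcut, hconn⟩ x hx
    constructor
    · intro hx0
      by_contra hxA
      obtain ⟨w⟩ := hx0
      rcases exists_exit (T := (↑S : Set (Vertex d))) (A := (↑A : Set (Vertex d))) ⟨hx, hxA⟩ w with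
        h | ⟨a, b, haA, hbA, hadj, -, -⟩
      · exact (mem_diff_of_connIn_diff ⟨hx, hxA⟩ h).2 h0
      · obtain ⟨⟨h1, h2, h3, h4⟩, -⟩ := inGraph_adj.1 hadj
        exact hcut s(a, b) ⟨⟨h2, fun v hv => by rcases Sym2.mem_iff.1 hv with rfl | rfl <;> assumption⟩,
          ⟨a, Sym2.mem_mk_left a b, haA⟩, ⟨b, Sym2.mem_mk_right a b, hbA⟩⟩ h1
    · intro hxA
      exact connIn_mono_set (Finset.coe_subset.2 hA) (hconn x hxA)

/-- `{C = A}` is determined by `E_A` (`0 ∈ A ⊆ S`). -/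
theorem determinedBy_cEq {S A : Finset (Vertex d)} (hA : A ⊆ S) (h0 : (0 : Vertex d) ∈ A) :
    DeterminedBy (touchBonds (↑S) (↑A)) (CEq S A) := by
  intro ω ω' h
  rw [cEq_iff hA h0, cEq_iff hA h0]
  apply and_congr
  · exact forall₂_congr fun e he => not_congr (h e (cutBonds_subset_touchBonds _ _ he))
  · exact forall₂_congr fun x _ => determinedBy_connIn ((A : Set (Vertex d))) 0 x ω ω' fun e he =>
      h e (bondsIn_subset_touchBonds (Finset.coe_subset.2 hA) he)

/-- SHARP Claim 2, second part: an open bond from `x ∈ C = A` to `y ∉ A` leaves `S`. -/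
theorem notMem_of_exit {S A : Finset (Vertex d)} {ω : Config d} (hC : ω ∈ CEq S A) {x y : Vertex d} (hx : x ∈ A)
    (hxS : x ∈ S) (hω : s(x, y) ∈ ω) (hb : s(x, y) ∈ bonds d) (hy : y ∉ A) : y ∉ (↑S : Set (Vertex d)) := by
  intro hyS
  have h0x : ConnIn (↑S) ω 0 x := (mem_cEq_iff_connIn hC hxS).1 hx
  have h0y : ConnIn (↑S) ω 0 y := h0x.trans (connIn_of_adj hω hb hxS hyS)
  exact hy ((mem_cEq_iff_connIn hC hyS).2 h0y)

/-! ### The partition by the cluster value -/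

/-- `P(B) = ∑_A P({C = A} ∩ B)` over `0 ∈ A ⊆ S` (`0 ∈ S`). -/
theorem P_eq_sum_cEq {S : Finset (Vertex d)} (hS : (0 : Vertex d) ∈ S) (p : I) {B : Set (Config d)}
    (hB : MeasurableSet B) : P d p B = ∑ A ∈ clusters S, P d p (CEq S A ∩ B) := by
  have hrepr : B = ⋃ A ∈ clusters S, (CEq S A ∩ B) := by
    ext ω
    simp only [mem_iUnion, mem_inter_iff, exists_prop]
    constructor
    · intro hω
      obtain ⟨A, hA, hC⟩ := exists_cEq hS ω
      exact ⟨A, hA, hC, hω⟩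
    · rintro ⟨A, -, -, hω⟩
      exact hω
  conv_lhs => rw [hrepr]
  refine measure_biUnion_finset ?_ fun A _ => (measurableSet_cEq S A).inter hB
  intro A hA A' hA' hne
  simp only [Function.onFun]
  rw [Set.disjoint_left]
  rintro ω ⟨h1, -⟩ ⟨h2, -⟩
  exact hne (cEq_eq (mem_clusters.1 hA).1 (mem_clusters.1 hA').1 h1 h2)

/-- `P(0 ↔_S x) = ∑_{A ∋ x} P(C = A)` for `x ∈ S` (`0 ∈ S`). -/
theorem P_connIn_eq_sum_cEq {S : Finset (Vertex d)} (hS : (0 : Vertex d) ∈ S) (p : I) {x : Vertex d} (hx : x ∈ S) :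
    P d p {ω : Config d | ConnIn (↑S) ω 0 x} = ∑ A ∈ (clusters S).filter (fun A => x ∈ A), P d p (CEq S A) := by
  have hrepr : {ω : Config d | ConnIn (↑S) ω 0 x} = ⋃ A ∈ (clusters S).filter (fun A => x ∈ A), CEq S A := by
    ext ω
    simp only [mem_setOf_eq, mem_iUnion, Finset.mem_filter, exists_prop]
    constructor
    · intro hω
      obtain ⟨A, hA, hC⟩ := exists_cEq hS ω
      exact ⟨A, ⟨hA, (mem_cEq_iff_connIn hC hx).2 hω⟩, hC⟩
    · rintro ⟨A, ⟨-, hxA⟩, hC⟩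
      exact (mem_cEq_iff_connIn hC hx).1 hxA
  rw [hrepr]
  refine measure_biUnion_finset ?_ fun A _ => measurableSet_cEq S A
  intro A hA A' hA' hne
  simp only [Function.onFun]
  rw [Set.disjoint_left]
  intro ω h1 h2
  exact hne (cEq_eq (mem_clusters.1 (Finset.mem_filter.1 hA).1).1 (mem_clusters.1 (Finset.mem_filter.1 hA').1).1 h1 h2)

end Summit.Ventures.PercRepro0.Sharp
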